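import Literature.InformationTheory.QuantumCodes.BivariateBicycleCodes
import HarnessLib

/-!
# The census family `F_semi`: membership tests (census/SYMMETRIES.md v1.1 (p1)–(p3)) in the kernel

LADDER-QEC grid A.1's table of record is the family `F_semi` of bivariate-bicycle pairs whose blocks `A`,
`B` are each "3 distinct monomials from the literal alphabet `{1, x, …, x^{ℓ−1}, y, …, y^{m−1}}`"
(CENSUS-PREREG v1.1 P1.2), DERIVED from the general `3+3` enumeration by the membership tests of
census/SYMMETRIES.md v1.1 (qec-search-3; checked by qec-ref-1 2026-08-26T19:06:16Z by hand and by brute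
force on ten presentations). This file PROVES those tests once and for all, for an arbitrary product
group `G₁ × G₂` (the census: `ℤ_ℓ × ℤ_m`; `X = G₁ × {0}` the powers of `x`, `Y = {0} × G₂` the powers
of `y`):

* (p1) **`isPurePowerTranslate_iff_splits`** — a finite `T ⊂ G₁ × G₂` is a translate of a subset of
  `X ∪ Y` iff `T = P ⊔ Q` with the `y`-coordinate constant on `P` and the `x`-coordinate constant on `Q`;
* (p2) **`isXTranslate_iff`, `isYTranslate_iff`** — `T` is a translate of a subset of `X` (resp. `Y`) iff
  `y` (resp. `x`) is constant on `T` («univariate» blocks);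
* (p3) **translation invariance** of all three properties (`isPurePowerTranslate_image_add_iff`, …), the
  step that makes the test a CLASS-level test under the (s1) translations.

Census vocabulary, no code parameters involved (the parameter-preserving symmetries themselves are the
Literature files `CSSEquivalence` / `TwoBlockCodeEquivalences` / `TwoBlockCosetDecomposition`). [proved]
-/

namespace Summit.Ventures.QEC.BB.Family

variable {G₁ G₂ : Type*} [AddCommGroup G₁] [AddCommGroup G₂]

/-- `T` is a translate of a set of PURE POWERS: for some `u`, every `t ∈ T` has `t − u ∈ X ∪ Y`, i.e.
`t − u` has zero `y`-coordinate (a power of `x`) or zero `x`-coordinate (a power of `y`).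
(census/SYMMETRIES.md v1.1 (p1): "T = u + S with S ⊂ X ∪ Y".) [definition] -/
def IsPurePowerTranslate (T : Finset (G₁ × G₂)) : Prop :=
  ∃ u : G₁ × G₂, ∀ t ∈ T, (t - u).2 = 0 ∨ (t - u).1 = 0

/-- `T` is a translate of a set of powers of `x` (census (p2), «univariate in x»). [definition] -/
def IsXTranslate (T : Finset (G₁ × G₂)) : Prop :=
  ∃ u : G₁ × G₂, ∀ t ∈ T, (t - u).2 = 0

/-- `T` is a translate of a set of powers of `y` (census (p2), «univariate in y»). [definition] -/
def IsYTranslate (T : Finset (G₁ × G₂)) : Prop :=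
  ∃ u : G₁ × G₂, ∀ t ∈ T, (t - u).1 = 0

omit [AddCommGroup G₁] [AddCommGroup G₂] in
/-- The SPLIT condition of (p1): `T = P ⊔ Q` with `y` constant on `P` and `x` constant on `Q` (`P` or `Q`
may be empty). [definition] -/
def Splits [DecidableEq G₁] [DecidableEq G₂] (T : Finset (G₁ × G₂)) : Prop :=
  ∃ P Q : Finset (G₁ × G₂), Disjoint P Q ∧ P ∪ Q = T ∧
    (∀ p ∈ P, ∀ p' ∈ P, p.2 = p'.2) ∧ (∀ q ∈ Q, ∀ q' ∈ Q, q.1 = q'.1)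

/-! ### (p2) univariate translates -/

/-- **(p2), `x`**: `T` is a translate of a subset of `X` iff the `y`-coordinate is constant on `T`.
(census/SYMMETRIES.md v1.1 (p2): "u + (i,0) has y-coordinate y(u); conversely take u = (0, y_T)".) [proved] -/
theorem isXTranslate_iff (T : Finset (G₁ × G₂)) :
    IsXTranslate T ↔ ∀ t ∈ T, ∀ t' ∈ T, t.2 = t'.2 := by
  constructor
  · rintro ⟨u, hu⟩ t ht t' ht'
    have h1 := hu t ht
    have h2 := hu t' ht'
    simp only [Prod.snd_sub, sub_eq_zero] at h1 h2
    rw [h1, h2]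
  · intro h
    by_cases hT : T.Nonempty
    · obtain ⟨t₀, ht₀⟩ := hT
      refine ⟨t₀, fun t ht => ?_⟩
      simp only [Prod.snd_sub, sub_eq_zero]
      exact h t ht t₀ ht₀
    · refine ⟨0, fun t ht => absurd ⟨t, ht⟩ hT⟩

/-- **(p2), `y`**: `T` is a translate of a subset of `Y` iff the `x`-coordinate is constant on `T`. [proved] -/
theorem isYTranslate_iff (T : Finset (G₁ × G₂)) :
    IsYTranslate T ↔ ∀ t ∈ T, ∀ t' ∈ T, t.1 = t'.1 := by
  constructor
  · rintro ⟨u, hu⟩ t ht t' ht'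
    have h1 := hu t ht
    have h2 := hu t' ht'
    simp only [Prod.fst_sub, sub_eq_zero] at h1 h2
    rw [h1, h2]
  · intro h
    by_cases hT : T.Nonempty
    · obtain ⟨t₀, ht₀⟩ := hT
      refine ⟨t₀, fun t ht => ?_⟩
      simp only [Prod.fst_sub, sub_eq_zero]
      exact h t ht t₀ ht₀
    · refine ⟨0, fun t ht => absurd ⟨t, ht⟩ hT⟩

/-! ### (p1) pure-power translates ⇔ split -/

/-- **(p1) LEMMA (pure-power translates)**: a finite `T ⊂ G₁ × G₂` is a translate of a subset of `X ∪ Y`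
iff `T = P ⊔ Q` with `y` constant on `P` and `x` constant on `Q`.
Proof as in census/SYMMETRIES.md v1.1: (⇒) `P = u + (S ∩ X)`, `Q` the rest; (⇐) `u = (x_Q, y_P)`. [proved] -/
theorem isPurePowerTranslate_iff_splits [DecidableEq G₁] [DecidableEq G₂] (T : Finset (G₁ × G₂)) :
    IsPurePowerTranslate T ↔ Splits T := by
  constructor
  · rintro ⟨u, hu⟩
    refine ⟨T.filter (fun t => (t - u).2 = 0), T.filter (fun t => ¬ (t - u).2 = 0),
      Finset.disjoint_filter_filter_not T T (p := fun t => (t - u).2 = 0),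
      Finset.filter_union_filter_not_eq (p := fun t => (t - u).2 = 0) T, ?_, ?_⟩
    · intro p hp p' hp'
      simp only [Finset.mem_filter, Prod.snd_sub, sub_eq_zero] at hp hp'
      rw [hp.2, hp'.2]
    · intro q hq q' hq'
      simp only [Finset.mem_filter] at hq hq'
      have h1 : (q - u).1 = 0 := (hu q hq.1).resolve_left hq.2
      have h2 : (q' - u).1 = 0 := (hu q' hq'.1).resolve_left hq'.2
      simp only [Prod.fst_sub, sub_eq_zero] at h1 h2
      rw [h1, h2]
  · rintro ⟨P, Q, -, hPQ, hP, hQ⟩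
    classical
    -- the common `y` on `P` and the common `x` on `Q` (anything if empty)
    let yP : G₂ := if h : P.Nonempty then h.choose.2 else 0
    let xQ : G₁ := if h : Q.Nonempty then h.choose.1 else 0
    refine ⟨(xQ, yP), fun t ht => ?_⟩
    rw [← hPQ, Finset.mem_union] at ht
    rcases ht with htP | htQ
    · left
      have hne : P.Nonempty := ⟨t, htP⟩
      have hy : yP = hne.choose.2 := dif_pos hne
      simp only [Prod.snd_sub, sub_eq_zero, hy]
      exact hP t htP _ hne.choose_spec
    · right
      have hne : Q.Nonempty := ⟨t, htQ⟩
      have hx : xQ = hne.choose.1 := dif_pos hne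
      simp only [Prod.fst_sub, sub_eq_zero, hx]
      exact hQ t htQ _ hne.choose_spec

omit [AddCommGroup G₁] [AddCommGroup G₂] in
/-- Remark used by the sweep ("any T with two elements sharing an x-coordinate or sharing a
y-coordinate splits: the third element alone is the other part"): every `T` with at most ONE element off
a `y`-constant subset splits — stated as: if `y` is constant on `T.erase t₀` then `T` splits. [proved] -/
theorem splits_of_snd_const_erase [DecidableEq G₁] [DecidableEq G₂] (T : Finset (G₁ × G₂)) (t₀ : G₁ × G₂)
    (h : ∀ t ∈ T.erase t₀, ∀ t' ∈ T.erase t₀, t.2 = t'.2) : Splits T := by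
  by_cases ht₀ : t₀ ∈ T
  · refine ⟨T.erase t₀, {t₀}, ?_, ?_, h, ?_⟩
    · simp
    · ext t
      simp only [Finset.mem_union, Finset.mem_erase, Finset.mem_singleton]
      constructor
      · rintro (⟨-, ht⟩ | rfl) <;> assumption
      · intro ht
        by_cases htt : t = t₀
        · exact Or.inr htt
        · exact Or.inl ⟨htt, ht⟩
    · intro q hq q' hq'
      simp only [Finset.mem_singleton] at hq hq'
      rw [hq, hq']
  · refine ⟨T, ∅, by simp, by simp, ?_, by simp⟩
    rw [Finset.erase_eq_of_notMem ht₀] at h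
    exact h

/-! ### (p3) translation invariance (so the tests are tests on (s1)-classes) -/

/-- Translating `T` does not change (p1). (census/SYMMETRIES.md v1.1 (p3).) [proved] -/
theorem isPurePowerTranslate_image_add_iff [DecidableEq G₁] [DecidableEq G₂] (T : Finset (G₁ × G₂))
    (v : G₁ × G₂) : IsPurePowerTranslate (T.image (· + v)) ↔ IsPurePowerTranslate T := by
  constructor
  · rintro ⟨u, hu⟩
    refine ⟨u - v, fun t ht => ?_⟩
    have := hu (t + v) (Finset.mem_image_of_mem _ ht)
    have e : t + v - u = t - (u - v) := by abel
    rwa [e] at this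
  · rintro ⟨u, hu⟩
    refine ⟨u + v, fun t ht => ?_⟩
    obtain ⟨s, hs, rfl⟩ := Finset.mem_image.1 ht
    have := hu s hs
    have e : s - u = s + v - (u + v) := by abel
    rwa [e] at this

/-- Translating `T` does not change «univariate in x». [proved] -/
theorem isXTranslate_image_add_iff [DecidableEq G₁] [DecidableEq G₂] (T : Finset (G₁ × G₂)) (v : G₁ × G₂) :
    IsXTranslate (T.image (· + v)) ↔ IsXTranslate T := by
  constructor
  · rintro ⟨u, hu⟩
    refine ⟨u - v, fun t ht => ?_⟩
    have := hu (t + v) (Finset.mem_image_of_mem _ ht)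
    have e : t + v - u = t - (u - v) := by abel
    rwa [e] at this
  · rintro ⟨u, hu⟩
    refine ⟨u + v, fun t ht => ?_⟩
    obtain ⟨s, hs, rfl⟩ := Finset.mem_image.1 ht
    have := hu s hs
    have e : s - u = s + v - (u + v) := by abel
    rwa [e] at this

/-- Translating `T` does not change «univariate in y». [proved] -/
theorem isYTranslate_image_add_iff [DecidableEq G₁] [DecidableEq G₂] (T : Finset (G₁ × G₂)) (v : G₁ × G₂) :
    IsYTranslate (T.image (· + v)) ↔ IsYTranslate T := by
  constructor
  · rintro ⟨u, hu⟩
    refine ⟨u - v, fun t ht => ?_⟩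
    have := hu (t + v) (Finset.mem_image_of_mem _ ht)
    have e : t + v - u = t - (u - v) := by abel
    rwa [e] at this
  · rintro ⟨u, hu⟩
    refine ⟨u + v, fun t ht => ?_⟩
    obtain ⟨s, hs, rfl⟩ := Finset.mem_image.1 ht
    have := hu s hs
    have e : s - u = s + v - (u + v) := by abel
    rwa [e] at this

/-- A univariate-in-`x` set is in particular a pure-power translate (so `F_semi ⊇` the semi-univariate
pairs; «not BOTH univariate» is the only exclusion). [proved] -/
theorem IsXTranslate.isPurePowerTranslate {T : Finset (G₁ × G₂)} (h : IsXTranslate T) :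
    IsPurePowerTranslate T := by
  obtain ⟨u, hu⟩ := h
  exact ⟨u, fun t ht => Or.inl (hu t ht)⟩

/-- Likewise for univariate-in-`y`. [proved] -/
theorem IsYTranslate.isPurePowerTranslate {T : Finset (G₁ × G₂)} (h : IsYTranslate T) :
    IsPurePowerTranslate T := by
  obtain ⟨u, hu⟩ := h
  exact ⟨u, fun t ht => Or.inr (hu t ht)⟩

/-- Decidable instance check on the census's benchmark exponents: the `[[72,12,6]]` block
`A = x³ + y + y²` (exponent set `{(3,0), (0,1), (0,2)} ⊂ ℤ₆ × ℤ₆`) is a pure-power translate (indeed a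
pure-power set, `u = 0`), and it is NOT univariate. [proved] -/
theorem bb72_A_isPurePowerTranslate :
    IsPurePowerTranslate ({((3 : ZMod 6), (0 : ZMod 6)), (0, 1), (0, 2)} : Finset (ZMod 6 × ZMod 6)) ∧
      ¬ IsXTranslate ({((3 : ZMod 6), (0 : ZMod 6)), (0, 1), (0, 2)} : Finset (ZMod 6 × ZMod 6)) := by
  constructor
  · exact ⟨0, by decide⟩
  · rw [isXTranslate_iff]
    decide

end Summit.Ventures.QEC.BB.Family
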